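import Summits.AtomisticToContinuum.BoseEinsteinCondensation.Theorems.BECProbeMassFlowCloudMomentumAtomPinningBorn
import Summits.AtomisticToContinuum.BoseEinsteinCondensation.Theorems.BECProbeMassFlowCloudMomentumAtomClusteringReduction
import Summits.AtomisticToContinuum.BoseEinsteinCondensation.Theorems.BECConjugateDominationHardCoreExtensionUniformGapTransfer
import Summits.AtomisticToContinuum.BoseEinsteinCondensation.Theorems.BECConjugateDominationIMUChainGlueEnergy
import Literature.MathematicalPhysics.QuantumManyBody.TorusPoincareInequality
import Summits.AtomisticToContinuum.BoseEinsteinCondensation.Theorems.BECInsertionCorrectorStaticResponseBoundTruncationMonotone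
import HarnessLib

/-!
# Fixed-`N` certificate for the infrared stub of crux `BECProbeMassFlow.CloudMomentumAtom`
# (item stmt-AtomisticToContinuum-12310, line `registered`, lead c4)

The registered stub `stub_fidelityForEach` (skeleton v9) asserts the "∀Φ ∃Ψ" Anderson fidelity with the
quantifier order `∃ ρ₀ ∀ ρ < ρ₀ ∀ᶠ N` — UNIFORMLY in the particle number along the thermodynamic boxes
`L = sideLength ρ (N + 1)`. This file proves, for every admissible INTEGRABLE `v`, the same statement with
the quantifiers swapped, `∀ N ∃ ρ₀(N)` (equivalently: for each `N`, on every sufficiently large torus), and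
even in the stronger "∀Φ ∀Ψ, one slack" endpoint form. So the entire open content of the stub is the
uniformity in `N`: at fixed `N` the free-gas spectral gap `(2π/L)²` beats the Born cost `N L⁻³ ∫v` of
pinning the scatterer as `L → ∞`, whereas along `L = sideLength ρ (N+1)` the gap `∼ L⁻²` is `o(ρ)`.

Mechanism (all inputs in the tree):
* `ofReal_sq_le_kyFanTwo_zero` — **the free Ky Fan gap** `(2π/L)² ≤ kyFanTwo 0 N L`: for an
  `L²(cell^N)`-orthogonal pair of periodic trial states, the Poincaré–Wirtinger inequality
  `1 ≤ L^{3N}|ĉ₀(Ψⱼ)|² + (L/2π)² ∫|∇Ψⱼ|²` (`lintegral_cellN_normSq_le`) and Bessel for the constant mode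
  (`sum_sq_setIntegral_mul_le_one`: `∑ⱼ L^{-3N}|∫Ψⱼ|² ≤ 1`) give `∫|∇Ψ₁|² + ∫|∇Ψ₂|² ≥ (2π/L)²`;
* monotonicity in `v ≥ 0` (`periodicEnergy_mono_of_le`) and the constant-state bound
  `2E₀ ≤ N² L⁻³ ∫v` (`Theorems.IMUChainGlue.periodicGroundStateEnergy_le_pairs`) give the Ky Fan gap
  `2E₀ + 2π²/L² ≤ kyFanTwo v N L` once `N² ∫v ≤ 2π² L`;
* the Born bound `E_imp ≤ E^per + N L⁻³ ∫v` (`impurityPeriodicGroundStateEnergy_le_add_born`, p155422)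
  makes every pinned `δ`-near-minimiser a free `(N L⁻³∫v + δ)`-near-minimiser;
* the explicit clustering modulus from a Ky Fan gap
  (`UniformGapTransfer.exists_phase_integral_norm_sub_sq_le_of_kyFanGap_explicit`: slack `γε/16`) and the
  phase-to-overlap dictionary (`ofReal_le_sq_nnnorm_integral_of_phase`, p150972) give the overlap
  `≥ 1 − ε` as soon as `N L⁻³ ∫v ≤ π²ε/(16 L²)`, i.e. for `L ≥ 16 N ∫v/(π² ε)`.

Results: `endpointFidelity_fixedN` (every box `L ≥ L₀(v, ε, N)`), `endpointFidelity_fixedN_density`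
(`∀ N ∃ ρ₀ ∀ ρ < ρ₀` at `L = sideLength ρ (N + 1)`), and `stub_fidelityForEach_fixedN` — the registered
stub's body verbatim with `∀ N, ∃ ρ₀` in place of `∃ ρ₀, ∀ ρ, ∀ᶠ N` (integrable `v`).
-/

noncomputable section

namespace Summit.AtomisticToContinuum.BoseEinsteinCondensation.Cruxes.CloudMomentumAtom.Birth

open MeasureTheory Filter
open scoped ENNReal NNReal BigOperators ComplexConjugate
open Literature.MathematicalPhysics.QuantumManyBody.BoseGas
open Literature.MathematicalPhysics.QuantumManyBody
open Summit.AtomisticToContinuum.BoseEinsteinCondensation.Cruxes.HardCoreExtension.ThirdLawCurrentFloor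

variable {N : ℕ} {L : ℝ}

/-! ### The free Ky Fan gap `(2π/L)²` -/

/-- The zeroth Fourier term of the Poincaré–Wirtinger inequality is the squared overlap with the
constant mode: `L^{3N} |ĉ₀(Ψ)|² = L^{-3N} |∫_{cell^N} Ψ|²` (as `ofReal`). [folklore] -/
theorem volume_mul_sq_configFourierCoeff_zero (hL : 0 < L) (Ψ : PeriodicTrialState N L) :
    (ENNReal.ofReal L ^ 3) ^ N * (‖configFourierCoeff L Ψ.ψ 0‖₊ : ℝ≥0∞) ^ 2 =
      ENNReal.ofReal (((L ^ 3) ^ N)⁻¹ * ‖∫ X in cellN N L, Ψ.ψ X‖ ^ 2) := by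
  have hLN : 0 < (L ^ 3) ^ N := by positivity
  rw [configFourierCoeff_zero hL Ψ.contDiff.continuous.aestronglyMeasurable, ennnorm_sq_eq_ofReal,
    norm_smul, Real.norm_of_nonneg (by positivity), ← ENNReal.ofReal_pow hL.le,
    ← ENNReal.ofReal_pow (by positivity), ← ENNReal.ofReal_mul (by positivity)]
  congr 1
  have hL0 : L ≠ 0 := hL.ne'
  rw [mul_pow, ← mul_assoc]
  congr 1
  rw [← inv_pow, ← pow_mul, inv_pow, pow_mul, pow_two, inv_pow, ← mul_assoc,
    mul_inv_cancel₀ hLN.ne', one_mul]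

/-- The squared overlap with the normalised constant mode, Bessel form:
`(∫ c₀ re Ψ)² + (∫ c₀ im Ψ)² = L^{-3N} |∫ Ψ|²` for `c₀ = L^{-3N/2}`. [folklore] -/
theorem sq_setIntegral_const_mul_re_add (hL : 0 < L) (Ψ : PeriodicTrialState N L) :
    (∫ X in cellN N L, (Real.sqrt ((L ^ 3) ^ N))⁻¹ * (Ψ.ψ X).re) ^ 2 +
        (∫ X in cellN N L, (Real.sqrt ((L ^ 3) ^ N))⁻¹ * (Ψ.ψ X).im) ^ 2 =
      ((L ^ 3) ^ N)⁻¹ * ‖∫ X in cellN N L, Ψ.ψ X‖ ^ 2 := by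
  have hLN : 0 < (L ^ 3) ^ N := by positivity
  haveI : IsFiniteMeasure (volume.restrict (cellN N L)) :=
    isFiniteMeasure_restrict.2 (by
      rw [volume_cellN]; exact ENNReal.pow_ne_top (ENNReal.pow_ne_top ENNReal.ofReal_ne_top))
  have h0 : MemLp (fun _ : Config N => (Real.sqrt ((L ^ 3) ^ N))⁻¹) 2 (volume.restrict (cellN N L)) :=
    memLp_const _
  rw [← norm_sq_setIntegral_conj_mul_ofReal h0 Ψ]
  have hI : (∫ X in cellN N L, conj (Ψ.ψ X) * (((Real.sqrt ((L ^ 3) ^ N))⁻¹ : ℝ) : ℂ)) =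
      conj (∫ X in cellN N L, Ψ.ψ X) * (((Real.sqrt ((L ^ 3) ^ N))⁻¹ : ℝ) : ℂ) := by
    rw [integral_mul_const, integral_conj]
  rw [hI, norm_mul, RCLike.norm_conj, Complex.norm_real, Real.norm_of_nonneg (by positivity), mul_pow,
    inv_pow, Real.sq_sqrt hLN.le, mul_comm]

/-- **The free Ky Fan gap on the torus.** For every `N` and `L > 0`,
`(2π/L)² ≤ kyFanTwo 0 N L`: the kinetic energies of an `L²(cell^N)`-orthogonal pair of periodic trial
states sum to at least `(2π/L)²` (Poincaré–Wirtinger `lintegral_cellN_normSq_le` for each state, and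
Bessel `sum_sq_setIntegral_mul_le_one` for the constant mode: at most one unit of constant-mode weight
is available to the pair). [cite: LiebLoss2001, Thm. 8.11; LSSY2005, App. A (A.10)] -/
theorem ofReal_sq_le_kyFanTwo_zero (hL : 0 < L) (N : ℕ) :
    ENNReal.ofReal ((2 * Real.pi / L) ^ 2) ≤ kyFanTwo (0 : ℝ → ℝ≥0∞) N L := by
  refine le_iInf fun Ψ₁ => le_iInf fun Ψ₂ => le_iInf fun horth => ?_
  rw [StaticResponseBound.UvThomsonForceWave.periodicEnergy_zero_eq Ψ₁,
    StaticResponseBound.UvThomsonForceWave.periodicEnergy_zero_eq Ψ₂]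
  set C : ℝ≥0∞ := ENNReal.ofReal ((L / (2 * Real.pi)) ^ 2) with hC
  set T₁ : ℝ≥0∞ := ∫⁻ X in cellN N L, kineticDensity Ψ₁.ψ X
  set T₂ : ℝ≥0∞ := ∫⁻ X in cellN N L, kineticDensity Ψ₂.ψ X
  set a₁ : ℝ := ((L ^ 3) ^ N)⁻¹ * ‖∫ X in cellN N L, Ψ₁.ψ X‖ ^ 2
  set a₂ : ℝ := ((L ^ 3) ^ N)⁻¹ * ‖∫ X in cellN N L, Ψ₂.ψ X‖ ^ 2
  -- Poincaré–Wirtinger for each state: `1 ≤ ofReal aⱼ + C Tⱼ`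
  have hP₁ : 1 ≤ ENNReal.ofReal a₁ + C * T₁ := by
    have h := lintegral_cellN_normSq_le hL Ψ₁.contDiff Ψ₁.periodic
    rwa [Ψ₁.norm_eq, volume_mul_sq_configFourierCoeff_zero hL Ψ₁] at h
  have hP₂ : 1 ≤ ENNReal.ofReal a₂ + C * T₂ := by
    have h := lintegral_cellN_normSq_le hL Ψ₂.contDiff Ψ₂.periodic
    rwa [Ψ₂.norm_eq, volume_mul_sq_configFourierCoeff_zero hL Ψ₂] at h
  -- Bessel for the constant mode: `a₁ + a₂ ≤ 1`
  have ha₁ : 0 ≤ a₁ := by positivity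
  have ha₂ : 0 ≤ a₂ := by positivity
  have hB : a₁ + a₂ ≤ 1 := by
    have hLN : 0 < (L ^ 3) ^ N := by positivity
    haveI : IsFiniteMeasure (volume.restrict (cellN N L)) :=
      isFiniteMeasure_restrict.2 (by
        rw [volume_cellN]; exact ENNReal.pow_ne_top (ENNReal.pow_ne_top ENNReal.ofReal_ne_top))
    have h0 : MemLp (fun _ : Config N => (Real.sqrt ((L ^ 3) ^ N))⁻¹) 2
        (volume.restrict (cellN N L)) := memLp_const _
    have h0n : ∫ X in cellN N L, ((Real.sqrt ((L ^ 3) ^ N))⁻¹) ^ 2 ≤ 1 := by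
      rw [setIntegral_const, volume_real_cellN hL N, inv_pow, Real.sq_sqrt hLN.le, smul_eq_mul,
        mul_inv_cancel₀ hLN.ne']
    have h := sum_sq_setIntegral_mul_le_one h0 h0n Ψ₁ Ψ₂ horth
    rwa [sq_setIntegral_const_mul_re_add hL Ψ₁, sq_setIntegral_const_mul_re_add hL Ψ₂] at h
  -- sum: `2 ≤ 1 + C (T₁ + T₂)`, hence `1 ≤ C (T₁ + T₂)`
  have hsum : 1 + 1 ≤ 1 + C * (T₁ + T₂) := by
    calc (1 : ℝ≥0∞) + 1 ≤ (ENNReal.ofReal a₁ + C * T₁) + (ENNReal.ofReal a₂ + C * T₂) :=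
          add_le_add hP₁ hP₂
      _ = ENNReal.ofReal (a₁ + a₂) + C * (T₁ + T₂) := by
          rw [ENNReal.ofReal_add ha₁ ha₂]; ring
      _ ≤ 1 + C * (T₁ + T₂) := by
          gcongr
          rw [← ENNReal.ofReal_one]
          exact ENNReal.ofReal_le_ofReal hB
  have h1 : 1 ≤ C * (T₁ + T₂) := (ENNReal.add_le_add_iff_left ENNReal.one_ne_top).1 hsum
  -- multiply by `(2π/L)²`: `(2π/L)² (L/2π)² = 1`
  have hprod : ENNReal.ofReal ((2 * Real.pi / L) ^ 2) * C = 1 := by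
    rw [hC, ← ENNReal.ofReal_mul (by positivity), ← ENNReal.ofReal_one]
    congr 1
    field_simp
  calc ENNReal.ofReal ((2 * Real.pi / L) ^ 2)
      = ENNReal.ofReal ((2 * Real.pi / L) ^ 2) * 1 := (mul_one _).symm
    _ ≤ ENNReal.ofReal ((2 * Real.pi / L) ^ 2) * (C * (T₁ + T₂)) := mul_le_mul' le_rfl h1
    _ = T₁ + T₂ := by rw [← mul_assoc, hprod, one_mul]

/-! ### The Ky Fan gap of the interacting gas on a large torus at fixed `N` -/

/-- `2E₀(N, L) ≤ N² L⁻³ ∫_{ℝ³} v` for every `N` (constant trial state; `2·C(N,2) ≤ N²`; `E₀ = 0` for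
`N ≤ 1`). [folklore] -/
theorem two_mul_periodicGroundStateEnergy_le_sq (hL : 0 < L) {v : ℝ → ℝ≥0∞} (hv : Measurable v)
    (N : ℕ) :
    2 * periodicGroundStateEnergy v N L ≤
      ((N : ℝ≥0∞) ^ 2) * ((ENNReal.ofReal L ^ 3)⁻¹ * ∫⁻ x : Space, v ‖x‖) := by
  rcases N with _ | _ | m
  · -- `N = 0`: the constant state has energy `0`
    have h0 : periodicGroundStateEnergy v 0 L = 0 := by
      refine le_antisymm ?_ bot_le
      let Ψ : PeriodicTrialState 0 L :=
        ⟨fun _ => ((Real.sqrt ((L ^ 3) ^ 0))⁻¹ : ℂ), contDiff_const, fun _ _ _ => rfl, fun _ _ => rfl,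
          Summit.AtomisticToContinuum.BoseEinsteinCondensation.Theorems.IMUChainGlue.setLIntegral_nnnorm_constN_sq hL 0⟩
      refine (periodicGroundStateEnergy_le v Ψ).trans (le_of_eq ?_)
      refine (lintegral_congr fun X => ?_).trans lintegral_zero
      simp [Ψ, kineticDensity, periodicInteraction]
    rw [h0, mul_zero]
    exact bot_le
  · rw [periodicGroundStateEnergy_one hL v, mul_zero]
    exact bot_le
  · calc 2 * periodicGroundStateEnergy v (m + 2) L
        ≤ 2 * ((((m + 2).choose 2 : ℕ) : ℝ≥0∞) * ((ENNReal.ofReal L ^ 3)⁻¹ * ∫⁻ x : Space, v ‖x‖)) :=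
          mul_le_mul' le_rfl (Summit.AtomisticToContinuum.BoseEinsteinCondensation.Theorems.IMUChainGlue.periodicGroundStateEnergy_le_pairs
            hL hv m)
      _ = (2 * (((m + 2).choose 2 : ℕ) : ℝ≥0∞)) * ((ENNReal.ofReal L ^ 3)⁻¹ * ∫⁻ x : Space, v ‖x‖) := by
          ring
      _ ≤ (((m + 2 : ℕ) : ℝ≥0∞) ^ 2) * ((ENNReal.ofReal L ^ 3)⁻¹ * ∫⁻ x : Space, v ‖x‖) := by
          gcongr
          have h : 2 * (m + 2).choose 2 ≤ (m + 2) ^ 2 := by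
            rw [Nat.choose_two_right]
            calc 2 * ((m + 2) * (m + 2 - 1) / 2) ≤ (m + 2) * (m + 2 - 1) := Nat.mul_div_le _ _
              _ ≤ (m + 2) * (m + 2) := Nat.mul_le_mul_left _ (Nat.sub_le _ _)
              _ = (m + 2) ^ 2 := (sq _).symm
          exact_mod_cast h

/-- **Ky Fan gap at fixed `N` on a large torus.** If `∫ v < ∞` and `N² ∫v ≤ 2π² L` then
`2E₀ + 2π²/L² ≤ kyFanTwo v N L` (free gap `(2π/L)²`, monotonicity in `v ≥ 0`, and `2E₀ ≤ N² ∫v / L³ ≤ 2π²/L²`).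
[folklore] -/
theorem kyFanGap_fixedN (hL : 0 < L) {v : ℝ → ℝ≥0∞} (hv : Measurable v)
    (hint : (∫⁻ x : Space, v ‖x‖) ≠ ⊤) (N : ℕ)
    (hlarge : (N : ℝ) ^ 2 * (∫⁻ x : Space, v ‖x‖).toReal ≤ 2 * Real.pi ^ 2 * L) :
    2 * periodicGroundStateEnergy v N L + ENNReal.ofReal (2 * Real.pi ^ 2 / L ^ 2) ≤ kyFanTwo v N L := by
  set I : ℝ := (∫⁻ x : Space, v ‖x‖).toReal with hI
  have hI0 : 0 ≤ I := ENNReal.toReal_nonneg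
  -- `2E₀ ≤ ofReal (N² I / L³)`
  have hE : 2 * periodicGroundStateEnergy v N L ≤ ENNReal.ofReal ((N : ℝ) ^ 2 * I / L ^ 3) := by
    refine (two_mul_periodicGroundStateEnergy_le_sq hL hv N).trans (le_of_eq ?_)
    rw [← ENNReal.ofReal_toReal hint, ← hI, ← ENNReal.ofReal_pow hL.le, ← ENNReal.ofReal_inv_of_pos
      (by positivity), ← ENNReal.ofReal_mul (by positivity)]
    have hN : ((N : ℝ≥0∞) ^ 2) = ENNReal.ofReal ((N : ℝ) ^ 2) := by
      rw [ENNReal.ofReal_pow (Nat.cast_nonneg _), ENNReal.ofReal_natCast]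
    rw [hN, ← ENNReal.ofReal_mul (by positivity)]
    congr 1
    field_simp
  -- `N² I / L³ + 2π²/L² ≤ (2π/L)²`
  have h1 : (N : ℝ) ^ 2 * I / L ^ 3 ≤ 2 * Real.pi ^ 2 / L ^ 2 := by
    rw [div_le_div_iff₀ (by positivity) (by positivity)]
    calc (N : ℝ) ^ 2 * I * L ^ 2 ≤ 2 * Real.pi ^ 2 * L * L ^ 2 :=
        mul_le_mul_of_nonneg_right hlarge (by positivity)
      _ = 2 * Real.pi ^ 2 * L ^ 3 := by ring
  have hsum : (N : ℝ) ^ 2 * I / L ^ 3 + 2 * Real.pi ^ 2 / L ^ 2 ≤ (2 * Real.pi / L) ^ 2 := by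
    calc (N : ℝ) ^ 2 * I / L ^ 3 + 2 * Real.pi ^ 2 / L ^ 2
        ≤ 2 * Real.pi ^ 2 / L ^ 2 + 2 * Real.pi ^ 2 / L ^ 2 := add_le_add h1 le_rfl
      _ = (2 * Real.pi / L) ^ 2 := by
        have hL0 : L ≠ 0 := hL.ne'
        field_simp
        ring
  calc 2 * periodicGroundStateEnergy v N L + ENNReal.ofReal (2 * Real.pi ^ 2 / L ^ 2)
      ≤ ENNReal.ofReal ((N : ℝ) ^ 2 * I / L ^ 3) + ENNReal.ofReal (2 * Real.pi ^ 2 / L ^ 2) :=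
        add_le_add hE le_rfl
    _ = ENNReal.ofReal ((N : ℝ) ^ 2 * I / L ^ 3 + 2 * Real.pi ^ 2 / L ^ 2) :=
        (ENNReal.ofReal_add (by positivity) (by positivity)).symm
    _ ≤ ENNReal.ofReal ((2 * Real.pi / L) ^ 2) := ENNReal.ofReal_le_ofReal hsum
    _ ≤ kyFanTwo 0 N L := ofReal_sq_le_kyFanTwo_zero hL N
    _ ≤ kyFanTwo v N L := by
        unfold kyFanTwo
        exact iInf_mono fun Ψ₁ => iInf_mono fun Ψ₂ => iInf_mono fun _ =>
          add_le_add (periodicEnergy_mono_of_le (fun _ => bot_le) Ψ₁)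
            (periodicEnergy_mono_of_le (fun _ => bot_le) Ψ₂)

/-! ### The endpoint fidelity at fixed `N` -/

/-- **Fixed-`N` endpoint fidelity (every large torus).** For every repulsive finite-range `v` with
`∫_{ℝ³} v(|x|) dx < ∞`, every `ε > 0` and every `N` there is `L₀` such that on every torus of side
`L ≥ L₀` there is ONE slack `δ > 0` for which EVERY `δ`-near-minimiser `Φ` of the pinned-scatterer energy
(scatterer at the origin) and EVERY `δ`-near-minimiser `Ψ` of the free periodic energy satisfy
`1 − ε ≤ |⟨Ψ, Φ⟩|²`. Proof: `L₀ = max(1, N²∫v/(2π²), 16 N ∫v/(π² ε))`; the free Ky Fan gap is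
`≥ 2π²/L²` (`kyFanGap_fixedN`), pinning costs at most the Born term `N L⁻³ ∫v ≤ π²ε/(16L²)`
(`impurityPeriodicGroundStateEnergy_le_add_born`), so with `δ = π²ε/(16L²)` both `Φ` and `Ψ` are free
near-minimisers within the explicit clustering slack `γε/16 = π²ε/(8L²)`
(`exists_phase_integral_norm_sub_sq_le_of_kyFanGap_explicit`), whence the overlap. The open stub
`stub_fidelityForEach` is this statement with `L₀` NOT allowed to depend on `N`
(`L = sideLength ρ (N+1)`, `ρ < ρ₀(ε, v)`, eventually in `N`). [folklore] -/
theorem endpointFidelity_fixedN :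
    ∀ (v : ℝ → ℝ≥0∞), IsRepulsiveFiniteRange v → (∫⁻ x : Space, v ‖x‖) ≠ ⊤ →
      ∀ ε : ℝ, 0 < ε → ∀ N : ℕ, ∃ L₀ : ℝ, 0 < L₀ ∧ ∀ L : ℝ, L₀ ≤ L →
        ∃ δ : ℝ≥0∞, 0 < δ ∧ ∀ Φ Ψ : PeriodicTrialState N L,
          impurityPeriodicEnergy v 0 Φ ≤ impurityPeriodicGroundStateEnergy v N L 0 + δ →
          periodicEnergy v Ψ ≤ periodicGroundStateEnergy v N L + δ →
          ENNReal.ofReal (1 - ε) ≤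
            (‖∫ X in cellN N L, conj (Ψ.ψ X) * Φ.ψ X‖₊ : ℝ≥0∞) ^ 2 := by
  intro v hv hint ε hε N
  set I : ℝ := (∫⁻ x : Space, v ‖x‖).toReal with hI
  have hI0 : 0 ≤ I := ENNReal.toReal_nonneg
  refine ⟨max 1 (max ((N : ℝ) ^ 2 * I / (2 * Real.pi ^ 2)) (16 * N * I / (Real.pi ^ 2 * ε))),
    lt_max_of_lt_left one_pos, fun L hL0 => ?_⟩
  have hL1 : 1 ≤ L := le_trans (le_max_left _ _) hL0
  have hL : 0 < L := one_pos.trans_le hL1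
  have hLa : (N : ℝ) ^ 2 * I / (2 * Real.pi ^ 2) ≤ L :=
    le_trans ((le_max_left _ _).trans (le_max_right _ _)) hL0
  have hLb : 16 * N * I / (Real.pi ^ 2 * ε) ≤ L :=
    le_trans ((le_max_right _ _).trans (le_max_right _ _)) hL0
  have hπ := Real.pi_pos
  -- the Ky Fan gap `γ = 2π²/L²`
  have hlarge : (N : ℝ) ^ 2 * I ≤ 2 * Real.pi ^ 2 * L := by
    rwa [div_le_iff₀ (by positivity), mul_comm L] at hLa
  have hgap := kyFanGap_fixedN hL hv.1 hint N hlarge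
  set γ : ℝ := 2 * Real.pi ^ 2 / L ^ 2 with hγ
  have hγ0 : 0 < γ := by positivity
  -- finiteness of the free infimum
  have hE : periodicGroundStateEnergy v N L ≠ ⊤ := by
    have h2 := two_mul_periodicGroundStateEnergy_le_sq hL hv.1 N
    have hfin : ((N : ℝ≥0∞) ^ 2) * ((ENNReal.ofReal L ^ 3)⁻¹ * ∫⁻ x : Space, v ‖x‖) ≠ ⊤ := by
      refine ENNReal.mul_ne_top (ENNReal.pow_ne_top ENNReal.coe_ne_top) (ENNReal.mul_ne_top ?_ hint)
      exact ENNReal.inv_ne_top.2 (pow_ne_zero _ (ENNReal.ofReal_pos.2 hL).ne')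
    have h1 : periodicGroundStateEnergy v N L ≤ 2 * periodicGroundStateEnergy v N L := by
      calc periodicGroundStateEnergy v N L = 1 * periodicGroundStateEnergy v N L := (one_mul _).symm
        _ ≤ 2 * periodicGroundStateEnergy v N L := mul_le_mul' (by norm_num) le_rfl
    exact ne_top_of_le_ne_top hfin (h1.trans h2)
  -- the slack `δ = π²ε/(16L²)`, half the clustering slack `γε/16 = π²ε/(8L²)`
  set d : ℝ := Real.pi ^ 2 * ε / (16 * L ^ 2) with hd
  have hd0 : 0 < d := by positivity
  have hdd : d + d = γ * ε / 16 := by rw [hd, hγ]; ring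
  -- the Born term is at most `d`
  have hborn : (N : ℝ≥0∞) * (ENNReal.ofReal (L ^ 3))⁻¹ * ∫⁻ y in cell L, periodizedPotential v L y ≤
      ENNReal.ofReal d := by
    rw [born_term_eq hv.1 N hL, ← ENNReal.ofReal_toReal hint, ← hI,
      ← ENNReal.ofReal_inv_of_pos (by positivity), ← ENNReal.ofReal_natCast,
      ← ENNReal.ofReal_mul (Nat.cast_nonneg _), ← ENNReal.ofReal_mul (by positivity)]
    refine ENNReal.ofReal_le_ofReal ?_
    rw [hd, le_div_iff₀ (by positivity)]
    rw [div_le_iff₀ (by positivity)] at hLb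
    have hL3 : (N : ℝ) * (L ^ 3)⁻¹ * I * (16 * L ^ 2) = 16 * N * I / L := by
      field_simp
    rw [hL3, div_le_iff₀ hL]
    nlinarith [hLb, mul_le_mul_of_nonneg_left hL1 (by positivity : (0 : ℝ) ≤ Real.pi ^ 2 * ε * L)]
  refine ⟨ENNReal.ofReal d, ENNReal.ofReal_pos.2 hd0, fun Φ Ψ hΦ hΨ => ?_⟩
  -- `Φ` is a free `(d + d)`-near-minimiser, `Ψ` a free `d`-near-minimiser
  have hΦfree : periodicEnergy v Φ ≤ periodicGroundStateEnergy v N L + ENNReal.ofReal (γ * ε / 16) := by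
    calc periodicEnergy v Φ ≤ impurityPeriodicEnergy v 0 Φ := periodicEnergy_le_impurityPeriodicEnergy v 0 Φ
      _ ≤ impurityPeriodicGroundStateEnergy v N L 0 + ENNReal.ofReal d := hΦ
      _ ≤ periodicGroundStateEnergy v N L +
            (N : ℝ≥0∞) * (ENNReal.ofReal (L ^ 3))⁻¹ * (∫⁻ y in cell L, periodizedPotential v L y) +
            ENNReal.ofReal d := by
          gcongr
          exact impurityPeriodicGroundStateEnergy_le_add_born hv.1 N hL 0
      _ ≤ periodicGroundStateEnergy v N L + ENNReal.ofReal d + ENNReal.ofReal d := by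
          gcongr
      _ = periodicGroundStateEnergy v N L + ENNReal.ofReal (γ * ε / 16) := by
          rw [add_assoc, ← ENNReal.ofReal_add hd0.le hd0.le, hdd]
  have hΨfree : periodicEnergy v Ψ ≤ periodicGroundStateEnergy v N L + ENNReal.ofReal (γ * ε / 16) := by
    refine hΨ.trans (add_le_add le_rfl (ENNReal.ofReal_le_ofReal ?_))
    rw [← hdd]; linarith
  obtain ⟨θ, hθ⟩ := UniformGapTransfer.exists_phase_integral_norm_sub_sq_le_of_kyFanGap_explicit hv.1 hγ0
    hE hgap hε Ψ Φ hΨfree hΦfree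
  exact ofReal_le_sq_nnnorm_integral_of_phase Ψ Φ hθ

/-- **Fixed-`N` endpoint fidelity, density form.** The same at the crux's boxes: for every `N` there is
`ρ₀(v, ε, N) > 0` such that for `0 < ρ < ρ₀`, at `L = sideLength ρ (N + 1)`, one slack serves all pinned
and all free near-minimisers (`L³ = (N+1)/ρ ≥ L₀³` for `ρ ≤ (N+1)/L₀³`). [folklore] -/
theorem endpointFidelity_fixedN_density :
    ∀ (v : ℝ → ℝ≥0∞), IsRepulsiveFiniteRange v → (∫⁻ x : Space, v ‖x‖) ≠ ⊤ →
      ∀ ε : ℝ, 0 < ε → ∀ N : ℕ, ∃ ρ₀ : ℝ, 0 < ρ₀ ∧ ∀ ρ : ℝ, 0 < ρ → ρ < ρ₀ →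
        ∀ L : ℝ, L = sideLength ρ (N + 1) →
          ∃ δ : ℝ≥0∞, 0 < δ ∧ ∀ Φ Ψ : PeriodicTrialState N L,
            impurityPeriodicEnergy v 0 Φ ≤ impurityPeriodicGroundStateEnergy v N L 0 + δ →
            periodicEnergy v Ψ ≤ periodicGroundStateEnergy v N L + δ →
            ENNReal.ofReal (1 - ε) ≤
              (‖∫ X in cellN N L, conj (Ψ.ψ X) * Φ.ψ X‖₊ : ℝ≥0∞) ^ 2 := by
  intro v hv hint ε hε N
  obtain ⟨L₀, hL₀, H⟩ := endpointFidelity_fixedN v hv hint ε hε N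
  refine ⟨((N : ℝ) + 1) / L₀ ^ 3, by positivity, fun ρ hρ hρlt L hL => H L ?_⟩
  -- `L₀ ≤ sideLength ρ (N + 1)` because `L₀³ ≤ (N + 1)/ρ`
  rw [hL]
  unfold sideLength
  rw [show (1 / 3 : ℝ) = (3 : ℝ)⁻¹ by norm_num,
    Real.le_rpow_inv_iff_of_pos hL₀.le (by positivity) (by norm_num : (0 : ℝ) < 3),
    show (3 : ℝ) = ((3 : ℕ) : ℝ) by norm_num, Real.rpow_natCast, le_div_iff₀ hρ]
  have := (lt_div_iff₀ (by positivity : (0 : ℝ) < L₀ ^ 3)).1 hρlt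
  push_cast
  linarith

/-- **The registered stub at fixed `N` (integrable `v`), PROVED.** The body of `stub_fidelityForEach`
verbatim, with the quantifier order `∀ N, ∃ ρ₀` in place of `∃ ρ₀, ∀ ρ < ρ₀, ∀ᶠ N`: for every repulsive
finite-range `v` with `∫ v < ∞`, `ε > 0` and `N` there is `ρ₀ > 0` such that for `0 < ρ < ρ₀`, at
`L = sideLength ρ (N + 1)` (the finiteness hypotheses are then automatic but kept for the verbatim shape),
for every free slack `δ₂ > 0` there is a pinned slack `δ₁ > 0` such that every pinned `δ₁`-near-minimiser
has a free `δ₂`-near-minimiser at overlap `≥ 1 − ε`. So the open content of the stub is exactly the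
uniformity of `ρ₀` (equivalently of the eventual-`N` threshold) in `N`. [folklore] -/
theorem stub_fidelityForEach_fixedN :
    ∀ (v : ℝ → ℝ≥0∞), IsRepulsiveFiniteRange v → (∫⁻ x : Space, v ‖x‖) ≠ ⊤ → ∀ ε : ℝ, 0 < ε →
      ∀ N : ℕ, ∃ ρ₀ : ℝ, 0 < ρ₀ ∧ ∀ ρ : ℝ, 0 < ρ → ρ < ρ₀ →
        ∀ L : ℝ, L = sideLength ρ (N + 1) →
          periodicGroundStateEnergy v N L ≠ ⊤ →
          impurityPeriodicGroundStateEnergy v N L 0 ≠ ⊤ →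
          ∀ δ₂ : ℝ≥0∞, 0 < δ₂ → ∃ δ₁ : ℝ≥0∞, 0 < δ₁ ∧
            ∀ Φ : PeriodicTrialState N L,
              impurityPeriodicEnergy v 0 Φ ≤ impurityPeriodicGroundStateEnergy v N L 0 + δ₁ →
              ∃ Ψ : PeriodicTrialState N L,
                periodicEnergy v Ψ ≤ periodicGroundStateEnergy v N L + δ₂ ∧
                ENNReal.ofReal (1 - ε) ≤
                  (‖∫ X in cellN N L, conj (Ψ.ψ X) * Φ.ψ X‖₊ : ℝ≥0∞) ^ 2 := by
  intro v hv hint ε hε N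
  obtain ⟨ρ₀, hρ₀, H⟩ := endpointFidelity_fixedN_density v hv hint ε hε N
  refine ⟨ρ₀, hρ₀, fun ρ hρ hρlt L hL hEper _ δ₂ hδ₂ => ?_⟩
  obtain ⟨δ, hδ, K⟩ := H ρ hρ hρlt L hL
  refine ⟨min δ δ₂, lt_min hδ hδ₂, fun Φ hΦ => ?_⟩
  have hlt : periodicGroundStateEnergy v N L < periodicGroundStateEnergy v N L + min δ δ₂ :=
    ENNReal.lt_add_right hEper (lt_min hδ hδ₂).ne'
  obtain ⟨Ψ, hΨ⟩ := iInf_lt_iff.1 hlt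
  refine ⟨Ψ, hΨ.le.trans (add_le_add le_rfl (min_le_right _ _)), ?_⟩
  exact K Φ Ψ (hΦ.trans (add_le_add le_rfl (min_le_left _ _)))
    (hΨ.le.trans (add_le_add le_rfl (min_le_left _ _)))

end Summit.AtomisticToContinuum.BoseEinsteinCondensation.Cruxes.CloudMomentumAtom.Birth

end
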